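import Mathlib.NumberTheory.JacobiSum.Basic
import Mathlib.NumberTheory.Padics.PadicNumbers
import Mathlib.NumberTheory.Padics.PadicIntegers
import Mathlib.Analysis.Normed.Group.Ultra
import Literature.NumberTheory.GaussSums.StickelbergerCongruence
import HarnessLib

/-!
# Jacobi sums of `p`-adic Teichmüller powers: Stickelberger's congruence and the `p`-adic valuation
# (Lang, *Cyclotomic Fields* I, Ch. 1 §2, Thm. 2.1 — the case `q = p`, values in `ℚ_p`)

Topic `Literature/NumberTheory/GaussSums`. `Proofs` file: theorems only, no definition, no named
fact (net debt 0). Companion of `StickelbergerCongruence.lean` (same directory), which proves Lang's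
Theorem 2.1 — `ord_𝔓 S(ω^{−k}) = s(k)` — for a general finite field `𝔽_q` and an ABSTRACT
Teichmüller datum `ω : 𝔽_q → R`, `ω(u) ≡ u (mod P)`, with the conclusion as membership in powers of an
ideal `P` of `R`. This file records the `q = p` case for characters with values in the `p`-ADIC
NUMBERS `ℚ_p` — where the congruences are statements about the `p`-adic norm and no auxiliary ring,
ideal or root of unity is needed — in the form consumed by `p`-adic interpolation arguments (the
`p`-adic absolute value of the Gauss sum of a character `ω^t` of order `3, 4, 6` is read off the
Jacobi sums `J(ω^t, ω^{tj})` through `G(χ)^e = χ(−1)·p·∏ J(χ, χ^j)`, Mathlib's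
`gaussSum_pow_eq_prod_jacobiSum`, and each Jacobi sum of Teichmüller powers is a RATIONAL `p`-adic
number whose norm is `1` or `p⁻¹` by the congruence below).

## Statements (Lang, GTM 121, Ch. 1 §2, proof of Thm. 2.1, "Case 2": the Jacobi sum of Teichmüller
powers modulo `𝔓` is a binomial power sum over `𝔽_p`; Stickelberger 1890)

Let `p` be a prime and `χ₁, χ₂ : (ℤ/p)^× → ℚ_p` multiplicative characters which are TEICHMÜLLER
POWERS: `‖χᵢ(a) − a^{tᵢ}‖_p < 1` for all `a ≢ 0`, with `1 ≤ tᵢ ≤ p − 2` (so `χᵢ = ω^{tᵢ}` for the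
Teichmüller character `ω`, `ω(a) ≡ a (mod p)`; the hypothesis is the tree's
`CensusX43.IsTeichmullerPow` shape, restated inline since Literature cannot import Summits).

* `norm_jacobiSum_sub_sum_lt_one` — `‖J(χ₁, χ₂) − Σ_{x mod p} x^{t₁}(1 − x)^{t₂}‖_p < 1` (the sum of
  the NATURAL-number representatives, cast to `ℚ_p`).
* `sum_pow_mul_one_sub_pow_zmod` — in `𝔽_p`: `Σ_x x^{t₁}(1 − x)^{t₂} = −(−1)^{p−1−t₁}·C(t₂, p−1−t₁)`
  if `p − 1 ≤ t₁ + t₂`, and `= 0` if `t₁ + t₂ < p − 1` (binomial expansion + the power sums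
  `Σ_x x^e`, `0 < e < 2(p−1)`, of `StickelbergerCongruence.sum_pow_eq_ite`).
* `norm_jacobiSum_lt_one_of_add_lt` — `t₁ + t₂ < p − 1 ⟹ ‖J(χ₁, χ₂)‖_p < 1`;
  `norm_jacobiSum_eq_one_of_lt_add` — `p − 1 < t₁ + t₂ ⟹ ‖J(χ₁, χ₂)‖_p = 1`;
  `norm_jacobiSum_eq_inv_of_add_lt` — `t₁ + t₂ < p − 1` (and `χ₁, χ₂ ≠ 1`) ⟹ `‖J(χ₁, χ₂)‖_p = p⁻¹`
  (with `J(χ₁,χ₂)·J(χ₁⁻¹,χ₂⁻¹) = p`, Mathlib's `jacobiSum_mul_jacobiSum_inv`).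
  In Stickelberger's notation `χᵢ = ω^{−aᵢ}`, `aᵢ = p − 1 − tᵢ`: `ord_p J(ω^{−a₁}, ω^{−a₂}) = 0` if
  `a₁ + a₂ < p − 1` and `= 1` if `a₁ + a₂ > p − 1` — the `q = p` case of
  `ord_𝔓 J = (s(a₁) + s(a₂) − s(a₁ + a₂))` (Lang Thm. 2.1 with `J = S S / S`).

## References
* S. Lang, *Cyclotomic Fields I and II*, GTM 121 (1990), Ch. 1 §1 (GS 3) and §2 Thm. 2.1 with its
  proof, Case 2 (held `book:lang1990-cyclotomic-fields-i-ii`, chunks p0021–p0023). [Lang1990]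
* K. Ireland, M. Rosen, *A Classical Introduction to Modern Number Theory*, GTM 84, Ch. 8 §3–§4
  (Jacobi sums, `|J|² = p`). [IrelandRosen1990]
-/

noncomputable section

open scoped Classical
open Finset

namespace Literature.NumberTheory.GaussSums

section TeichmullerPowers

variable {p : ℕ} [hp : Fact p.Prime]

/-- Values of a `ℚ_p`-valued character of `(ℤ/p)^×` at units have norm `1` (they are
`(p−1)`-th roots of unity). [folklore] -/
private theorem norm_mulChar_apply_eq_one (χ : MulChar (ZMod p) ℚ_[p]) {a : ZMod p} (ha : a ≠ 0) :
    ‖χ a‖ = 1 := by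
  have h1 : (χ a) ^ (p - 1) = 1 := by
    rw [← map_pow, ZMod.pow_card_sub_one_eq_one ha, map_one]
  have h2 : ‖χ a‖ ^ (p - 1) = 1 := by rw [← norm_pow, h1, norm_one]
  have hp1 : p - 1 ≠ 0 := by have := hp.out.two_le; omega
  exact (pow_eq_one_iff_of_nonneg (norm_nonneg _) hp1).mp h2

/-- Values of a `ℚ_p`-valued character of `ℤ/p` have norm `≤ 1`. [folklore] -/
private theorem norm_mulChar_apply_le_one (χ : MulChar (ZMod p) ℚ_[p]) (a : ZMod p) :
    ‖χ a‖ ≤ 1 := by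
  by_cases ha : a = 0
  · rw [ha, χ.map_nonunit (by simp), norm_zero]; exact zero_le_one
  · exact (norm_mulChar_apply_eq_one χ ha).le

/-- The congruence `χ(a) ≡ a^t` extends to `a = 0` when `t ≥ 1` (both sides vanish). [folklore] -/
private theorem norm_apply_sub_pow_lt_one {χ : MulChar (ZMod p) ℚ_[p]} {t : ℕ} (ht : 1 ≤ t)
    (hχ : ∀ a : ZMod p, a ≠ 0 → ‖χ a - ((a.val : ℕ) : ℚ_[p]) ^ t‖ < 1) (a : ZMod p) :
    ‖χ a - ((a.val : ℕ) : ℚ_[p]) ^ t‖ < 1 := by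
  by_cases ha : a = 0
  · rw [ha, χ.map_nonunit (by simp), ZMod.val_zero, Nat.cast_zero, zero_pow (by omega), sub_zero,
      norm_zero]
    exact zero_lt_one
  · exact hχ a ha

/-- **The Jacobi sum of two Teichmüller powers is congruent modulo `p` to the integer power sum
`Σ_{x mod p} x^{t₁}(1 − x)^{t₂}`** (natural representatives `0 ≤ x < p`; `tᵢ ≥ 1`): term by term
`χ₁(x)χ₂(1−x) ≡ x^{t₁}(1−x)^{t₂}` in `ℤ_p`, and the `p`-adic norm is non-archimedean. (Lang: "we use
GS 3 … `−J(ω^{−1}, ω^{−(k−1)}) ≡ Σ u^{−1}(1−u)^{−(k−1)+q−1} (mod 𝔓)`".)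
[cite: Lang1990, Ch. 1 §2 Thm. 2.1 (proof, Case 2)] -/
theorem norm_jacobiSum_sub_sum_lt_one {χ₁ χ₂ : MulChar (ZMod p) ℚ_[p]} {t₁ t₂ : ℕ}
    (ht₁ : 1 ≤ t₁) (ht₂ : 1 ≤ t₂)
    (h₁ : ∀ a : ZMod p, a ≠ 0 → ‖χ₁ a - ((a.val : ℕ) : ℚ_[p]) ^ t₁‖ < 1)
    (h₂ : ∀ a : ZMod p, a ≠ 0 → ‖χ₂ a - ((a.val : ℕ) : ℚ_[p]) ^ t₂‖ < 1) :
    ‖jacobiSum χ₁ χ₂ -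
        ∑ x : ZMod p, ((x.val : ℕ) : ℚ_[p]) ^ t₁ * (((1 - x).val : ℕ) : ℚ_[p]) ^ t₂‖ < 1 := by
  rw [jacobiSum, ← Finset.sum_sub_distrib]
  -- each term has norm `< 1`; the sum is bounded by the max (finite, non-empty)
  have hterm : ∀ x : ZMod p,
      ‖χ₁ x * χ₂ (1 - x) - ((x.val : ℕ) : ℚ_[p]) ^ t₁ * (((1 - x).val : ℕ) : ℚ_[p]) ^ t₂‖ < 1 := by
    intro x
    set a := χ₁ x
    set b := χ₂ (1 - x)
    set a' := ((x.val : ℕ) : ℚ_[p]) ^ t₁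
    set b' := (((1 - x).val : ℕ) : ℚ_[p]) ^ t₂
    have ha : ‖a - a'‖ < 1 := norm_apply_sub_pow_lt_one ht₁ h₁ x
    have hb : ‖b - b'‖ < 1 := norm_apply_sub_pow_lt_one ht₂ h₂ (1 - x)
    have hb1 : ‖b‖ ≤ 1 := norm_mulChar_apply_le_one χ₂ _
    have ha'1 : ‖a'‖ ≤ 1 := by
      rw [norm_pow]
      refine pow_le_one₀ (norm_nonneg _) ?_
      exact_mod_cast Padic.norm_int_le_one (p := p) (x.val : ℤ)
    have hsplit : a * b - a' * b' = (a - a') * b + a' * (b - b') := by ring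
    rw [hsplit]
    refine (IsUltrametricDist.norm_add_le_max _ _).trans_lt (max_lt ?_ ?_)
    · rw [norm_mul]
      calc ‖a - a'‖ * ‖b‖ ≤ ‖a - a'‖ * 1 := by gcongr
        _ < 1 := by rw [mul_one]; exact ha
    · rw [norm_mul]
      calc ‖a'‖ * ‖b - b'‖ ≤ 1 * ‖b - b'‖ := by gcongr
        _ < 1 := by rw [one_mul]; exact hb
  -- ultrametric bound for the finite sum
  obtain ⟨x₀, -, hx₀⟩ := IsUltrametricDist.exists_norm_finsetSum_le_of_nonempty
    (Finset.univ_nonempty (α := ZMod p))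
    (fun x : ZMod p ↦ χ₁ x * χ₂ (1 - x) -
      ((x.val : ℕ) : ℚ_[p]) ^ t₁ * (((1 - x).val : ℕ) : ℚ_[p]) ^ t₂)
  exact hx₀.trans_lt (hterm x₀)

/-- **The binomial power sum in `𝔽_p`.** For `1 ≤ t₁, t₂ ≤ p − 2`:
`Σ_{x ∈ 𝔽_p} x^{t₁}(1 − x)^{t₂} = −(−1)^{p−1−t₁}·C(t₂, p−1−t₁)` if `p − 1 ≤ t₁ + t₂`, and `= 0` if
`t₁ + t₂ < p − 1`: expand `(1 − x)^{t₂}` and use `Σ_x x^e = −[e = p−1]` for `0 < e < 2(p−1)`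
(`StickelbergerCongruence.sum_pow_eq_ite`); only `e = t₁ + m = p − 1` survives.
[cite: Lang1990, Ch. 1 §2 Thm. 2.1 (proof, Case 2: "If j ≠ 1 then Σ u^{j−1} = 0")] -/
theorem sum_pow_mul_one_sub_pow_zmod {t₁ t₂ : ℕ} (ht₁ : 1 ≤ t₁) (ht₁' : t₁ ≤ p - 2)
    (ht₂' : t₂ ≤ p - 2) :
    ∑ x : ZMod p, x ^ t₁ * (1 - x) ^ t₂ =
      if p - 1 ≤ t₁ + t₂ then -((-1 : ZMod p) ^ (p - 1 - t₁) * (Nat.choose t₂ (p - 1 - t₁) : ZMod p))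
      else 0 := by
  have hp2 := hp.out.two_le
  have hcard : Fintype.card (ZMod p) = p := ZMod.card p
  -- expand `(1 - x)^{t₂} = Σ_m C(t₂, m) (−x)^m`
  have hexp : ∀ x : ZMod p, x ^ t₁ * (1 - x) ^ t₂ =
      ∑ m ∈ range (t₂ + 1), ((-1) ^ m * (Nat.choose t₂ m : ZMod p)) * x ^ (t₁ + m) := by
    intro x
    rw [sub_eq_neg_add, add_pow, Finset.mul_sum]
    refine Finset.sum_congr rfl fun m _ ↦ ?_
    rw [one_pow, mul_one, neg_pow, pow_add]
    ring
  simp_rw [hexp]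
  rw [Finset.sum_comm]
  -- the inner power sums
  have hinner : ∀ m ∈ range (t₂ + 1),
      ∑ x : ZMod p, ((-1) ^ m * (Nat.choose t₂ m : ZMod p)) * x ^ (t₁ + m) =
        if t₁ + m = p - 1 then -((-1) ^ m * (Nat.choose t₂ m : ZMod p)) else 0 := by
    intro m hm
    rw [Finset.mem_range] at hm
    rw [← Finset.mul_sum]
    have he : 0 < t₁ + m := by omega
    have he2 : t₁ + m < 2 * (Fintype.card (ZMod p) - 1) := by rw [hcard]; omega
    rw [StickelbergerCongruence.sum_pow_eq_ite he he2, hcard]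
    split_ifs <;> simp
  rw [Finset.sum_congr rfl hinner]
  -- only `m = p − 1 − t₁` survives
  have hkey : ∀ m : ℕ, (t₁ + m = p - 1) ↔ m = p - 1 - t₁ := fun m ↦ by omega
  simp_rw [hkey, Finset.sum_ite_eq', Finset.mem_range]
  by_cases hle : p - 1 ≤ t₁ + t₂
  · rw [if_pos (show p - 1 - t₁ < t₂ + 1 by omega), if_pos hle]
  · rw [if_neg (show ¬ (p - 1 - t₁ < t₂ + 1) by omega), if_neg hle]

/-- The natural-representative power sum reduces to the `𝔽_p` power sum. [folklore] -/
private theorem natCast_sum_val_pow (t₁ t₂ : ℕ) :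
    (((∑ x : ZMod p, x.val ^ t₁ * (1 - x).val ^ t₂ : ℕ) : ℤ) : ZMod p) =
      ∑ x : ZMod p, x ^ t₁ * (1 - x) ^ t₂ := by
  push_cast
  refine Finset.sum_congr rfl fun x _ ↦ ?_
  rw [ZMod.natCast_zmod_val, ZMod.natCast_zmod_val]

/-- **`t₁ + t₂ < p − 1 ⟹ ‖J(χ₁, χ₂)‖_p < 1`** for Teichmüller powers `χᵢ = ω^{tᵢ}`, `1 ≤ tᵢ`
(the `𝔽_p` power sum vanishes). In Stickelberger's notation (`χᵢ = ω^{−aᵢ}`): `a₁ + a₂ > p − 1 ⟹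
p ∣ J(ω^{−a₁}, ω^{−a₂})`. [cite: Lang1990, Ch. 1 §2 Thm. 2.1] -/
theorem norm_jacobiSum_lt_one_of_add_lt {χ₁ χ₂ : MulChar (ZMod p) ℚ_[p]} {t₁ t₂ : ℕ}
    (ht₁ : 1 ≤ t₁) (ht₂ : 1 ≤ t₂) (hsum : t₁ + t₂ < p - 1)
    (h₁ : ∀ a : ZMod p, a ≠ 0 → ‖χ₁ a - ((a.val : ℕ) : ℚ_[p]) ^ t₁‖ < 1)
    (h₂ : ∀ a : ZMod p, a ≠ 0 → ‖χ₂ a - ((a.val : ℕ) : ℚ_[p]) ^ t₂‖ < 1) :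
    ‖jacobiSum χ₁ χ₂‖ < 1 := by
  have hJ := norm_jacobiSum_sub_sum_lt_one ht₁ ht₂ h₁ h₂
  -- the integer power sum is divisible by `p`
  set N : ℕ := ∑ x : ZMod p, x.val ^ t₁ * (1 - x).val ^ t₂ with hN
  have hNcast : (∑ x : ZMod p, ((x.val : ℕ) : ℚ_[p]) ^ t₁ * (((1 - x).val : ℕ) : ℚ_[p]) ^ t₂) =
      ((N : ℤ) : ℚ_[p]) := by
    rw [hN]; push_cast; rfl
  have hNp : ‖((N : ℤ) : ℚ_[p])‖ < 1 := by
    rw [Padic.norm_intCast_lt_one_iff]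
    have h0 : (((N : ℕ) : ℤ) : ZMod p) = 0 := by
      rw [hN, natCast_sum_val_pow, sum_pow_mul_one_sub_pow_zmod ht₁ (by omega) (by omega),
        if_neg (by omega)]
    exact (ZMod.intCast_zmod_eq_zero_iff_dvd _ p).mp h0
  rw [hNcast] at hJ
  calc ‖jacobiSum χ₁ χ₂‖ = ‖(jacobiSum χ₁ χ₂ - ((N : ℤ) : ℚ_[p])) + ((N : ℤ) : ℚ_[p])‖ := by
        rw [sub_add_cancel]
    _ ≤ max ‖jacobiSum χ₁ χ₂ - ((N : ℤ) : ℚ_[p])‖ ‖((N : ℤ) : ℚ_[p])‖ :=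
        IsUltrametricDist.norm_add_le_max _ _
    _ < 1 := max_lt hJ hNp

/-- **`p − 1 < t₁ + t₂ ⟹ ‖J(χ₁, χ₂)‖_p = 1`** for Teichmüller powers `χᵢ = ω^{tᵢ}`, `tᵢ ≤ p − 2`
(the `𝔽_p` power sum is `± C(t₂, p−1−t₁) ≢ 0`, a binomial coefficient with entries `< p`). In
Stickelberger's notation: `a₁ + a₂ < p − 1 ⟹ J(ω^{−a₁}, ω^{−a₂})` is a `p`-adic unit.
[cite: Lang1990, Ch. 1 §2 Thm. 2.1] -/
theorem norm_jacobiSum_eq_one_of_lt_add {χ₁ χ₂ : MulChar (ZMod p) ℚ_[p]} {t₁ t₂ : ℕ}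
    (ht₁' : t₁ ≤ p - 2) (ht₂' : t₂ ≤ p - 2) (hsum : p - 1 < t₁ + t₂)
    (h₁ : ∀ a : ZMod p, a ≠ 0 → ‖χ₁ a - ((a.val : ℕ) : ℚ_[p]) ^ t₁‖ < 1)
    (h₂ : ∀ a : ZMod p, a ≠ 0 → ‖χ₂ a - ((a.val : ℕ) : ℚ_[p]) ^ t₂‖ < 1) :
    ‖jacobiSum χ₁ χ₂‖ = 1 := by
  have hp2 := hp.out.two_le
  have ht₁ : 1 ≤ t₁ := by omega
  have ht₂ : 1 ≤ t₂ := by omega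
  have hJ := norm_jacobiSum_sub_sum_lt_one ht₁ ht₂ h₁ h₂
  set N : ℕ := ∑ x : ZMod p, x.val ^ t₁ * (1 - x).val ^ t₂ with hN
  have hNcast : (∑ x : ZMod p, ((x.val : ℕ) : ℚ_[p]) ^ t₁ * (((1 - x).val : ℕ) : ℚ_[p]) ^ t₂) =
      ((N : ℤ) : ℚ_[p]) := by
    rw [hN]; push_cast; rfl
  rw [hNcast] at hJ
  -- `N` is NOT divisible by `p`
  have hNunit : ‖((N : ℤ) : ℚ_[p])‖ = 1 := by
    refine le_antisymm (Padic.norm_int_le_one _) ?_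
    by_contra hlt
    rw [not_le, Padic.norm_intCast_lt_one_iff] at hlt
    have h0 : (((N : ℕ) : ℤ) : ZMod p) = 0 := (ZMod.intCast_zmod_eq_zero_iff_dvd _ p).mpr hlt
    rw [hN, natCast_sum_val_pow, sum_pow_mul_one_sub_pow_zmod ht₁ ht₁' ht₂', if_pos (by omega),
      neg_eq_zero, mul_eq_zero] at h0
    rcases h0 with h0 | h0
    · exact (pow_ne_zero _ (neg_ne_zero.mpr one_ne_zero)) h0
    · rw [ZMod.natCast_eq_zero_iff] at h0
      -- `p ∣ C(t₂, p−1−t₁)` is impossible: `C(t₂, k) ∣`-free argument via `t₂! `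
      have hk : p - 1 - t₁ ≤ t₂ := by omega
      have hdvd : p ∣ Nat.factorial t₂ := by
        have := Nat.choose_mul_factorial_mul_factorial hk
        rw [← this]
        exact dvd_mul_of_dvd_left (dvd_mul_of_dvd_left h0 _) _
      rw [hp.out.dvd_factorial] at hdvd
      omega
  -- ultrametric: `‖J − N‖ < 1 = ‖N‖ ⟹ ‖J‖ = ‖N‖`
  have hne : ‖((N : ℤ) : ℚ_[p])‖ ≠ ‖jacobiSum χ₁ χ₂ - ((N : ℤ) : ℚ_[p])‖ := by
    rw [hNunit]; exact (ne_of_gt hJ)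
  have hmax := IsUltrametricDist.norm_add_eq_max_of_norm_ne_norm hne
  rw [add_sub_cancel, hNunit, max_eq_left hJ.le] at hmax
  exact hmax

/-- A Jacobi sum of `ℚ_p`-valued characters of `ℤ/p` is a `p`-adic integer (its values are sums
of products of roots of unity; Ireland–Rosen Ch. 8 §3: `J(χ, λ)` is an algebraic integer).
[cite: IrelandRosen1990, Ch. 8 §3 (Jacobi sums are algebraic integers)] -/
theorem norm_jacobiSum_le_one (χ₁ χ₂ : MulChar (ZMod p) ℚ_[p]) : ‖jacobiSum χ₁ χ₂‖ ≤ 1 := by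
  rw [jacobiSum]
  obtain ⟨x₀, -, hx₀⟩ := IsUltrametricDist.exists_norm_finsetSum_le_of_nonempty
    (Finset.univ_nonempty (α := ZMod p)) (fun x : ZMod p ↦ χ₁ x * χ₂ (1 - x))
  refine hx₀.trans ?_
  rw [norm_mul]
  exact mul_le_one₀ (norm_mulChar_apply_le_one _ _) (norm_nonneg _) (norm_mulChar_apply_le_one _ _)

/-- **`t₁ + t₂ < p − 1 ⟹ ‖J(χ₁, χ₂)‖_p = p⁻¹`** for non-trivial Teichmüller powers `χᵢ = ω^{tᵢ}`
with `χ₁χ₂ ≠ 1`: `‖J‖ < 1` (`norm_jacobiSum_lt_one_of_add_lt`) and `J(χ₁,χ₂)·J(χ₁⁻¹,χ₂⁻¹) = p`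
(`|J|² = p`, Mathlib `jacobiSum_mul_jacobiSum_inv`) with `‖J(χ₁⁻¹,χ₂⁻¹)‖ ≤ 1`, and norms on `ℚ_p` are
integral powers of `p`. In Stickelberger's notation: `a₁ + a₂ > p − 1 ⟹ ord_p J(ω^{−a₁}, ω^{−a₂}) = 1`.
[cite: Lang1990, Ch. 1 §2 Thm. 2.1] [cite: IrelandRosen1990, Ch. 8 §3 Thm. 1 (|J|² = p)] -/
theorem norm_jacobiSum_eq_inv_of_add_lt {χ₁ χ₂ : MulChar (ZMod p) ℚ_[p]} {t₁ t₂ : ℕ}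
    (ht₁ : 1 ≤ t₁) (ht₂ : 1 ≤ t₂) (hsum : t₁ + t₂ < p - 1)
    (h₁ : ∀ a : ZMod p, a ≠ 0 → ‖χ₁ a - ((a.val : ℕ) : ℚ_[p]) ^ t₁‖ < 1)
    (h₂ : ∀ a : ZMod p, a ≠ 0 → ‖χ₂ a - ((a.val : ℕ) : ℚ_[p]) ^ t₂‖ < 1)
    (hχ₁ : χ₁ ≠ 1) (hχ₂ : χ₂ ≠ 1) (hχ : χ₁ * χ₂ ≠ 1) :
    ‖jacobiSum χ₁ χ₂‖ = (p : ℝ)⁻¹ := by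
  have hlt := norm_jacobiSum_lt_one_of_add_lt ht₁ ht₂ hsum h₁ h₂
  have hchar : ringChar ℚ_[p] ≠ ringChar (ZMod p) := by
    rw [ringChar.eq_zero, ZMod.ringChar_zmod_n]
    exact hp.out.ne_zero.symm
  have hprod := jacobiSum_mul_jacobiSum_inv hchar hχ₁ hχ₂ hχ
  rw [ZMod.card] at hprod
  have hnorm : ‖jacobiSum χ₁ χ₂‖ * ‖jacobiSum χ₁⁻¹ χ₂⁻¹‖ = (p : ℝ)⁻¹ := by
    rw [← norm_mul, hprod, Padic.norm_p]
  have hJ' : ‖jacobiSum χ₁⁻¹ χ₂⁻¹‖ ≤ 1 := norm_jacobiSum_le_one _ _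
  have hge : (p : ℝ)⁻¹ ≤ ‖jacobiSum χ₁ χ₂‖ := by
    calc (p : ℝ)⁻¹ = ‖jacobiSum χ₁ χ₂‖ * ‖jacobiSum χ₁⁻¹ χ₂⁻¹‖ := hnorm.symm
      _ ≤ ‖jacobiSum χ₁ χ₂‖ * 1 := by gcongr
      _ = ‖jacobiSum χ₁ χ₂‖ := mul_one _
  have hle : ‖jacobiSum χ₁ χ₂‖ ≤ (p : ℝ)⁻¹ := by
    have h := (Padic.norm_le_pow_iff_norm_lt_pow_add_one (jacobiSum χ₁ χ₂) (-1)).mpr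
      (by rw [show (-1 : ℤ) + 1 = 0 by norm_num, zpow_zero]; exact hlt)
    rwa [zpow_neg_one] at h
  exact le_antisymm hle hge

end TeichmullerPowers

end Literature.NumberTheory.GaussSums

end
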